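import Mathlib
import Summits.ValiantsHypothesis.ValiantsHypothesis.Theorems.BarrierLeverDefinableEquationsDefs
import Summits.ValiantsHypothesis.ValiantsHypothesis.Theorems.BarrierLeverDefinableEquationsStubDatumWitness
import Summits.ValiantsHypothesis.ValiantsHypothesis.Theorems.BarrierLeverDefinableEquationsSuccinctContraction

/-!
# Crux `BarrierLever.DefinableEquations` (stmt-8745) / item `SingleSizeEquations` (stmt-8749) —
# VALIANT'S CRITERION AT SCALE `N`, EXPONENT-VECTOR FORM: a polynomial whose COEFFICIENT FUNCTION
# is the Boolean-cube marginal of a small polynomial on bits is a Boolean sum (val-np-p5 g7)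

Companion of `…DefinableEquationsSuccinctContraction.lean` (index-function / contraction encoding
of monomials).  Here a monomial `X^m` of individual degrees `≤ D` in finitely many variables
`X_e` (`e : ι`) is encoded by the ONE-HOT graph of its exponent function `m : ι → Fin (D+1)`
(Boolean block `ι × Fin (D+1)`, bit `(e, j)` = "`m e = j`"), and a polynomial `Q` in the `X_e`
and the Boolean block `(ι × Fin (D+1)) ⊕ Fin r` (`r` auxiliary bits `w`) has the
EXPONENT-VECTOR SUM

  `F_Q = ∑_{m : ι → Fin (D+1)} ∑_{w : Fin r → Bool} Q(X; oneHot m, w) · ∏_e X_e^{m e}`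

— every monomial of individual degrees `≤ D` exactly once, with coefficient the Boolean-cube
marginal `∑_w Q(oneHot m, w)`; for `X`-free `Q` this is literally "the coefficient function of
`F_Q` is a `#P`-style function of the exponent vector" (Bürgisser 2000, Prop. 2.20).

* `CoefficientFunction.sum_graphRec_mul` — the function-graph recogniser on rows `α`, values `β`
  (BCS 1997, Prop. (21.15) technique; the `BPos` case is `DatumWitness.valid_spec`).
* `CoefficientFunction.exists_witness` — **`F_Q = boolSum H`** for an `H` on
  `Fin (|ι|·(D+1) + r)` Boolean variables with `L(H) ≤ L(Q) + 8 (|ι|+1) (D+2)²` and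
  `deg H ≤ deg Q + 2 (|ι|+1) (D+2)`: `H = rename ε (V · Q · ∏_e ∑_j Z_{e,j} X_e^j)`.

The converse (the coefficient function of every Boolean sum of individual degrees `≤ D` IS such a
marginal of an `X`-FREE polynomial of comparable size: multivariate discrete Fourier extraction)
is `…DefinableEquationsCoefficientExtraction.lean`; together they make the crux EQUIVALENT to the
existence of poly(`N`)-explicit coefficient functions (`…CoefficientFunctionCrux.lean`).
Route-independent (no `Theses` import); no definitions, no named facts.  Refs: P. Bürgisser,
*Completeness and Reduction in Algebraic Complexity Theory* (2000), Prop. 2.20, Rem. 2.2;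
Bürgisser–Clausen–Shokrollahi 1997, Prop. (21.15).
-/

set_option linter.dupNamespace false

noncomputable section

namespace Summit.ValiantsHypothesis.ValiantsHypothesis.Theorems.BarrierLeverDefinableEquations

open MvPolynomial Literature.Computability.AlgebraicComplexity
open Literature.Barriers.ValiantsHypothesis
open scoped BigOperators

namespace CoefficientFunction

/-! ### The function-graph recogniser on rows `α`, values `β` -/

section Recogniser

variable {R : Type*} [CommRing R] {α β : Type*}

/-- A function is determined by its one-hot graph. [folklore] -/
theorem graph_injective [DecidableEq β] :
    Function.Injective (fun (f : α → β) (p : α × β) => decide (f p.1 = p.2)) := by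
  intro f g h
  funext a
  have h1 := congrFun h (a, g a)
  simpa using h1

/-- The row recogniser `∑_b u_{a,b} ∏_{b' ≠ b} (1 - u_{a,b'})` is `1` at a one-hot row.
[folklore] -/
theorem rowRec_graph [Fintype β] [DecidableEq β] (f : α → β) (a : α) :
    ∑ b : β, (if decide (f a = b) then (1 : R) else 0) *
        ∏ b' ∈ Finset.univ.erase b, (1 - if decide (f a = b') then (1 : R) else 0) = 1 := by
  rw [Finset.sum_eq_single (f a)]
  · simp only [decide_true, if_true, one_mul]
    refine Finset.prod_eq_one fun b' hb' => ?_
    have h2 : f a ≠ b' := (Finset.ne_of_mem_erase hb').symm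
    simp [h2]
  · intro b _ hb
    have h2 : f a ≠ b := Ne.symm hb
    simp [h2]
  · exact fun h => absurd (Finset.mem_univ _) h

/-- The row recogniser vanishes at a row that is not one-hot. [folklore] -/
theorem rowRec_eq_zero [Fintype β] [DecidableEq β] {u : α × β → Bool} {a : α}
    (h : ∀ b₀ : β, ∃ b, u (a, b) ≠ decide (b₀ = b)) :
    ∑ b : β, (if u (a, b) then (1 : R) else 0) *
        ∏ b' ∈ Finset.univ.erase b, (1 - if u (a, b') then (1 : R) else 0) = 0 := by
  refine Finset.sum_eq_zero fun b _ => ?_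
  by_cases hb : u (a, b) = true
  · obtain ⟨b', hb'⟩ := h b
    have hne : b ≠ b' := by
      rintro rfl
      rw [hb] at hb'
      exact hb' (by simp)
    have hu : u (a, b') = true := by simpa [hne] using hb'
    rw [Finset.prod_eq_zero (Finset.mem_erase.2 ⟨fun h' => hne h'.symm, Finset.mem_univ _⟩)
      (by rw [hu, if_pos rfl, sub_self]), mul_zero]
  · rw [if_neg hb, zero_mul]

/-- **Boolean sums against the function-graph recogniser are sums over functions**:
`∑_u (∏_a rowRec_a(u)) G(u) = ∑_f G(graph f)`. [folklore] -/
theorem sum_graphRec_mul [Fintype α] [Fintype β] [DecidableEq α] [DecidableEq β]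
    (G : (α × β → Bool) → R) :
    ∑ u : α × β → Bool, (∏ a : α, ∑ b : β, (if u (a, b) then (1 : R) else 0) *
        ∏ b' ∈ Finset.univ.erase b, (1 - if u (a, b') then (1 : R) else 0)) * G u =
      ∑ f : α → β, G (fun p => decide (f p.1 = p.2)) := by
  classical
  have h : ∀ u : α × β → Bool, (∏ a : α, ∑ b : β, (if u (a, b) then (1 : R) else 0) *
      ∏ b' ∈ Finset.univ.erase b, (1 - if u (a, b') then (1 : R) else 0)) * G u =
      if ∃ f : α → β, (fun p : α × β => decide (f p.1 = p.2)) = u then G u else 0 := by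
    intro u
    split_ifs with hf
    · obtain ⟨f, rfl⟩ := hf
      rw [Finset.prod_eq_one fun a _ => rowRec_graph f a, one_mul]
    · push Not at hf
      obtain ⟨a, ha⟩ : ∃ a : α, ∀ b₀ : β, ∃ b, u (a, b) ≠ decide (b₀ = b) := by
        by_contra hall
        push Not at hall
        choose f hf' using hall
        exact hf f (funext fun ⟨a, b⟩ => (hf' a b).symm)
      rw [Finset.prod_eq_zero (Finset.mem_univ a) (rowRec_eq_zero ha), zero_mul]
  rw [Finset.sum_congr rfl fun u _ => h u, ← Finset.sum_filter]
  have hfi : (Finset.univ.filter fun u : α × β → Bool =>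
      ∃ f : α → β, (fun p : α × β => decide (f p.1 = p.2)) = u) =
      Finset.univ.image fun (f : α → β) (p : α × β) => decide (f p.1 = p.2) := by
    ext u
    simp
  rw [hfi, Finset.sum_image fun f _ g _ hfg => graph_injective hfg]

end Recogniser

/-! ### The witness -/

variable {ι : Type*} [Fintype ι]

/-- The recogniser polynomial `V = ∏_e ∑_j Z_{e,j} ∏_{j' ≠ j} (1 - Z_{e,j'})` on the Boolean block
`ι × Fin (D+1)`, existentially with its cost: Boolean sums against it are sums over exponent
functions, `L(V) ≤ 4 |ι| (D+2)²`, `deg V ≤ |ι| (D+1)`. [folklore] -/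
theorem exists_recogniser [DecidableEq ι] (D : ℕ) :
    ∃ V : MvPolynomial (ι ⊕ (ι × Fin (D + 1))) ℂ,
      (∀ G : (ι × Fin (D + 1) → Bool) → MvPolynomial ι ℂ,
        ∑ u, aeval (boolPt u) V * G u =
          ∑ m : ι → Fin (D + 1), G fun p => decide (m p.1 = p.2)) ∧
      complexity V ≤ 4 * Fintype.card ι * (D + 2) ^ 2 ∧
      V.totalDegree ≤ Fintype.card ι * (D + 1) := by
  refine ⟨∏ e : ι, ∑ j : Fin (D + 1), X (Sum.inr (e, j)) *
      ∏ j' ∈ Finset.univ.erase j, (1 - X (Sum.inr (e, j'))), fun G => ?_, ?_, ?_⟩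
  · simp only [map_prod, map_sum, map_mul, map_sub, map_one, aeval_X, boolPt, Sum.elim_inr]
    exact sum_graphRec_mul G
  · have hrow : ∀ e : ι, complexity (∑ j : Fin (D + 1), X (Sum.inr (e, j)) *
        ∏ j' ∈ Finset.univ.erase j, (1 - X (Sum.inr (e, j'))) :
          MvPolynomial (ι ⊕ (ι × Fin (D + 1))) ℂ) ≤ (D + 1) * (3 * (D + 1) + 1) + (D + 1) := by
      intro e
      have h := complexity_sum_le_of_le (Finset.univ : Finset (Fin (D + 1)))
        (fun j => (X (Sum.inr (e, j)) * ∏ j' ∈ Finset.univ.erase j, (1 - X (Sum.inr (e, j'))) :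
          MvPolynomial (ι ⊕ (ι × Fin (D + 1))) ℂ)) (3 * (D + 1) + 1) fun j _ => by
          have h1 := complexity_prod_le_of_le (Finset.univ.erase j)
            (fun j' => (1 - X (Sum.inr (e, j')) : MvPolynomial (ι ⊕ (ι × Fin (D + 1))) ℂ)) 2
            fun j' _ => DatumWitness.complexity_one_sub_X_le _
          have h2 := complexity_X_holds (k := ℂ) (Sum.inr (e, j) : ι ⊕ (ι × Fin (D + 1)))
          have h3 := complexity_mul_le_holds
            (X (Sum.inr (e, j)) : MvPolynomial (ι ⊕ (ι × Fin (D + 1))) ℂ)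
            (∏ j' ∈ Finset.univ.erase j, (1 - X (Sum.inr (e, j')) : MvPolynomial _ ℂ))
          have h4 : (Finset.univ.erase j).card ≤ D :=
            Nat.le_of_lt_succ ((Finset.card_erase_lt_of_mem (Finset.mem_univ j)).trans_eq
              (by rw [Finset.card_univ, Fintype.card_fin]))
          omega
      rw [Finset.card_univ, Fintype.card_fin] at h
      exact h
    refine (complexity_prod_le_of_le _ _ _ fun e _ => hrow e).trans ?_
    rw [Finset.card_univ]
    have h6 : (D + 1) * (3 * (D + 1) + 1) + (D + 1) + 1 ≤ 4 * (D + 2) ^ 2 := by nlinarith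
    calc Fintype.card ι * ((D + 1) * (3 * (D + 1) + 1) + (D + 1)) + Fintype.card ι
        = Fintype.card ι * ((D + 1) * (3 * (D + 1) + 1) + (D + 1) + 1) := by ring
      _ ≤ Fintype.card ι * (4 * (D + 2) ^ 2) := Nat.mul_le_mul_left _ h6
      _ = 4 * Fintype.card ι * (D + 2) ^ 2 := by ring
  · refine (totalDegree_prod_le_of_le _ _ (D + 1)
      fun e _ => totalDegree_sum_le_of_le _ _ _ fun j _ => ?_).trans ?_
    · have h1 := totalDegree_prod_le_of_le (Finset.univ.erase j)
        (fun j' => (1 - X (Sum.inr (e, j')) : MvPolynomial (ι ⊕ (ι × Fin (D + 1))) ℂ)) 1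
        fun j' _ => DatumWitness.totalDegree_one_sub_X_le _
      have h2 := totalDegree_X_le_one (k := ℂ) (Sum.inr (e, j) : ι ⊕ (ι × Fin (D + 1)))
      have h3 := totalDegree_mul
        (X (Sum.inr (e, j)) : MvPolynomial (ι ⊕ (ι × Fin (D + 1))) ℂ)
        (∏ j' ∈ Finset.univ.erase j, (1 - X (Sum.inr (e, j')) : MvPolynomial _ ℂ))
      have h4 : (Finset.univ.erase j).card ≤ D :=
        Nat.le_of_lt_succ ((Finset.card_erase_lt_of_mem (Finset.mem_univ j)).trans_eq
          (by rw [Finset.card_univ, Fintype.card_fin]))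
      omega
    · rw [Finset.card_univ]

/-- The monomial selector `M = ∏_e ∑_j Z_{e,j} X_e^j`, existentially with its cost: at the one-hot
point of `m` it is `∏_e X_e^{m e}`, `L(M) ≤ |ι| (D+2)² + |ι|`, `deg M ≤ |ι| (D+1)`. [folklore] -/
theorem exists_monomialSelector (D : ℕ) :
    ∃ M : MvPolynomial (ι ⊕ (ι × Fin (D + 1))) ℂ,
      (∀ m : ι → Fin (D + 1),
        aeval (boolPt fun p : ι × Fin (D + 1) => decide (m p.1 = p.2)) M =
          ∏ e : ι, X e ^ (m e : ℕ)) ∧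
      complexity M ≤ Fintype.card ι * (D + 2) ^ 2 + Fintype.card ι ∧
      M.totalDegree ≤ Fintype.card ι * (D + 1) := by
  refine ⟨∏ e : ι, ∑ j : Fin (D + 1), X (Sum.inr (e, j)) * X (Sum.inl e) ^ (j : ℕ),
    fun m => ?_, ?_, ?_⟩
  · rw [map_prod]
    refine Finset.prod_congr rfl fun e _ => ?_
    rw [map_sum, Finset.sum_eq_single (m e)]
    · simp [boolPt]
    · intro j _ hj
      have : m e ≠ j := Ne.symm hj
      simp [boolPt, this]
    · exact fun h => absurd (Finset.mem_univ _) h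
  · have hrow : ∀ e : ι, complexity (∑ j : Fin (D + 1),
        (X (Sum.inr (e, j)) * X (Sum.inl e) ^ (j : ℕ) : MvPolynomial (ι ⊕ (ι × Fin (D + 1))) ℂ))
          ≤ (D + 1) * (D + 1) + (D + 1) := by
      intro e
      have h := complexity_sum_le_of_le (Finset.univ : Finset (Fin (D + 1)))
        (fun j => (X (Sum.inr (e, j)) * X (Sum.inl e) ^ (j : ℕ) :
          MvPolynomial (ι ⊕ (ι × Fin (D + 1))) ℂ)) (D + 1) fun j _ => by
          -- `L(Z X^j) ≤ j + 1 ≤ D + 1`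
          have hpow : complexity (X (Sum.inl e) ^ (j : ℕ) :
              MvPolynomial (ι ⊕ (ι × Fin (D + 1))) ℂ) ≤ j := by
            have h := complexity_finset_prod_le (Finset.range j)
              (fun _ => (X (Sum.inl e) : MvPolynomial (ι ⊕ (ι × Fin (D + 1))) ℂ))
            rw [Finset.prod_const, Finset.card_range] at h
            refine h.trans ?_
            rw [Finset.sum_eq_zero fun _ _ => complexity_X_holds (k := ℂ) _, zero_add]
          have h3 := complexity_mul_le_holds
            (X (Sum.inr (e, j)) : MvPolynomial (ι ⊕ (ι × Fin (D + 1))) ℂ)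
            (X (Sum.inl e) ^ (j : ℕ))
          have h2 := complexity_X_holds (k := ℂ) (Sum.inr (e, j) : ι ⊕ (ι × Fin (D + 1)))
          have hj := j.2
          omega
      rw [Finset.card_univ, Fintype.card_fin] at h
      exact h
    refine (complexity_prod_le_of_le _ _ _ fun e _ => hrow e).trans ?_
    rw [Finset.card_univ]
    have h6 : (D + 1) * (D + 1) + (D + 1) ≤ (D + 2) ^ 2 := by nlinarith
    exact Nat.add_le_add_right (Nat.mul_le_mul_left _ h6) _
  · refine (totalDegree_prod_le_of_le _ _ (D + 1)
      fun e _ => totalDegree_sum_le_of_le _ _ _ fun j _ => ?_).trans ?_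
    · refine (totalDegree_mul _ _).trans ?_
      have h1 := totalDegree_X_le_one (k := ℂ) (Sum.inr (e, j) : ι ⊕ (ι × Fin (D + 1)))
      have h2 : (X (Sum.inl e) ^ (j : ℕ) : MvPolynomial (ι ⊕ (ι × Fin (D + 1))) ℂ).totalDegree
          ≤ j := (totalDegree_pow _ _).trans (by rw [totalDegree_X]; simp)
      have hj := j.2
      omega
    · rw [Finset.card_univ]

/-- **Valiant's criterion at scale `N`, exponent-vector form.**  For a finite variable type `ι`,
`D r : ℕ` and every `Q` on `ι ⊕ ((ι × Fin (D+1)) ⊕ Fin r)`, the exponent-vector sum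
`F_Q = ∑_{m : ι → Fin (D+1)} ∑_{w} Q(X; oneHot m, w) · ∏_e X_e^{m e}` is `boolSum H` for an `H`
on `Fin (|ι|·(D+1) + r)` Boolean variables with `L(H) ≤ L(Q) + 8 (|ι|+1) (D+2)²` and
`deg H ≤ deg Q + 2 (|ι|+1) (D+2)`. [cite: Burgisser2000, Prop. 2.20] -/
theorem exists_witness [DecidableEq ι] (D r : ℕ)
    (Q : MvPolynomial (ι ⊕ ((ι × Fin (D + 1)) ⊕ Fin r)) ℂ) :
    ∃ H : MvPolynomial (ι ⊕ Fin (Fintype.card ι * (D + 1) + r)) ℂ,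
      boolSum H = ∑ m : ι → Fin (D + 1), ∑ w : Fin r → Bool,
          aeval (boolPt (Sum.elim (fun p : ι × Fin (D + 1) => decide (m p.1 = p.2)) w)) Q *
            ∏ e : ι, X e ^ (m e : ℕ) ∧
      complexity H ≤ complexity Q + 8 * (Fintype.card ι + 1) * (D + 2) ^ 2 ∧
      H.totalDegree ≤ Q.totalDegree + 2 * (Fintype.card ι + 1) * (D + 2) := by
  classical
  obtain ⟨V, hV_v, hV_c, hV_d⟩ := exists_recogniser (ι := ι) D
  obtain ⟨M, hM_v, hM_c, hM_d⟩ := exists_monomialSelector (ι := ι) D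
  set I : ℕ := Fintype.card ι with hIdef
  let lift : MvPolynomial (ι ⊕ (ι × Fin (D + 1))) ℂ →
      MvPolynomial (ι ⊕ ((ι × Fin (D + 1)) ⊕ Fin r)) ℂ :=
    fun G => rename (Sum.map id (Sum.inl : ι × Fin (D + 1) → (ι × Fin (D + 1)) ⊕ Fin r)) G
  let ε : (ι × Fin (D + 1)) ⊕ Fin r ≃ Fin (I * (D + 1) + r) :=
    (Equiv.sumCongr (((Fintype.equivFin ι).prodCongr (Equiv.refl (Fin (D + 1)))).trans
      finProdFinEquiv) (Equiv.refl (Fin r))).trans finSumFinEquiv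
  refine ⟨rename (Sum.map id ε) (lift V * Q * lift M), ?_, ?_, ?_⟩
  · -- the Boolean sum
    rw [DatumWitness.boolSum_rename_eq, SuccinctContraction.sum_boolAssign_sum]
    calc ∑ u₁ : ι × Fin (D + 1) → Bool, ∑ w : Fin r → Bool,
          aeval (boolPt (Sum.elim u₁ w)) (lift V * Q * lift M)
        = ∑ u₁ : ι × Fin (D + 1) → Bool, aeval (boolPt u₁) V *
            ∑ w : Fin r → Bool, (aeval (boolPt (Sum.elim u₁ w)) Q * aeval (boolPt u₁) M) := by
          refine Finset.sum_congr rfl fun u₁ _ => ?_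
          rw [Finset.mul_sum]
          refine Finset.sum_congr rfl fun w _ => ?_
          rw [map_mul, map_mul]
          simp only [lift, SuccinctContraction.aeval_boolPt_elim_rename_inl]
          ring
      _ = ∑ m : ι → Fin (D + 1), ∑ w : Fin r → Bool,
            (aeval (boolPt (Sum.elim (fun p : ι × Fin (D + 1) => decide (m p.1 = p.2)) w)) Q *
              aeval (boolPt fun p : ι × Fin (D + 1) => decide (m p.1 = p.2)) M) :=
          hV_v fun u₁ => ∑ w : Fin r → Bool, (aeval (boolPt (Sum.elim u₁ w)) Q *
              aeval (boolPt u₁) M)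
      _ = _ := by
          refine Finset.sum_congr rfl fun m _ => Finset.sum_congr rfl fun w _ => ?_
          rw [hM_v m]
  · -- the size
    refine (complexity_rename_le_holds' _ _).trans ?_
    have c1 := complexity_mul_le_holds (lift V * Q) (lift M)
    have c2 := complexity_mul_le_holds (lift V) Q
    have cV : complexity (lift V) ≤ 4 * I * (D + 2) ^ 2 :=
      (complexity_rename_le_holds' _ _).trans hV_c
    have cM : complexity (lift M) ≤ I * (D + 2) ^ 2 + I :=
      (complexity_rename_le_holds' _ _).trans hM_c
    have f1 : I ≤ I * (D + 2) ^ 2 := Nat.le_mul_of_pos_right _ (by positivity)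
    have f2 : 2 ≤ 2 * (D + 2) ^ 2 := Nat.le_mul_of_pos_right _ (by positivity)
    nlinarith
  · -- the degree
    refine (totalDegree_rename_le _ _).trans ?_
    have d1 := totalDegree_mul (lift V * Q) (lift M)
    have d2 := totalDegree_mul (lift V) Q
    have dV : (lift V).totalDegree ≤ I * (D + 1) := (totalDegree_rename_le _ _).trans hV_d
    have dM : (lift M).totalDegree ≤ I * (D + 1) := (totalDegree_rename_le _ _).trans hM_d
    nlinarith

end CoefficientFunction

end Summit.ValiantsHypothesis.ValiantsHypothesis.Theorems.BarrierLeverDefinableEquations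

end
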